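import Summits.Ventures.LatticeQCDFlow.Scoring.U1TorusTopologicalChargeLaw
import HarnessLib

/-!
# Topological sectors of two-dimensional `U(1)` on the torus, III: the law of `Q` as a discrete measure, `⟨Q⟩ = 0`, `⟨Q²⟩`

HONEST FRAMING: exact (Metropolis-corrected) sampling algorithms for lattice gauge theory;
figures of merit are autocorrelation/cost numbers at stated couplings and volumes; no
continuum-physics claim.

Venture `LatticeQCDFlow` (cell pub-lqcd), sub-topic `Scoring`; FANOUT row 5 (`s0-sun-a`), GEN-8.
NEW WORK of the cell (placement rule); part 3, continuing `Scoring/U1TorusTopologicalChargeLaw.lean`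
(`μ_{Λ,β}{Q = k} = g_V(2πk)/Σ_j g_V(2πj)` for the Wilson measure of compact `U(1)` on `(ℤ/L)²` and
theory-2's `topCharge`).  The oracle `ORACLE-u1-2d.json` also records `Q2 = ⟨Q²⟩ = Σ_k k² π_k`
(`χ_Q = ⟨Q²⟩/V`) and asserts `⟨Q⟩ = 0` and that `π_k` is negligible beyond a finite range.  Here:

* `abs_topCharge_le` — `|Q(U)| ≤ L²/2` for every configuration (each `|arg U_x| ≤ π`); hence
  `wilsonMeasure_topCharge_eq_zero` (`P(Q = k) = 0`) and, through the law, the ANALYTIC corollary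
  `u1SectorWeight_eq_zero` (`g_{L²}(2πk) = 0`) for `|k| > L²/2`;
* `topCharge_mem_finset` / `sum_indicator_topCharge` — `Q` is a simple function:
  `f(Q(U)) = Σ_{|k| ≤ L²} f(k)·1{Q(U) = k}`;
* **`integral_comp_topCharge`** — `∫ f(Q) dμ_{Λ,β} = Σ_{|k| ≤ L²} f(k)·P(Q = k)` for every
  `f : ℝ → ℝ`, in particular **`integral_topCharge_sq`** `⟨Q²⟩ = Σ_k k²·π_k` (the oracle's `Q2`)
  and **`integral_topCharge`** `⟨Q⟩ = 0` (by `P(Q = −k) = P(Q = k)`);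
* **`wilsonMeasure_map_topCharge`** — the law of `Q` is the discrete measure `Σ_k P(Q = k) δ_k`.

Elementary; no new definition; nothing is cited.
-/

noncomputable section

open MeasureTheory Set Real Finset
open scoped ENNReal
open Literature.MathematicalPhysics.QuantumFieldTheory
open Literature.MathematicalPhysics.QuantumLattice (u1Rep u1Rep_apply continuous_u1Rep)
open Summit.Ventures.LatticeQCDFlow.Theory2.Lattice (topCharge exists_int_eq_topCharge
  measurable_topCharge)

namespace Summit.Ventures.LatticeQCDFlow.Scoring

variable (β : ℝ) {L : ℕ} [NeZero L]

/-! ### 1. `Q` is bounded by `L²/2` -/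

/-- **`|Q(U)| ≤ L²/2`**: each of the `L²` plaquette angles `arg U_x` lies in `(−π, π]`. -/
theorem abs_topCharge_le (U : GaugeConfig 2 L Circle) : |topCharge U| ≤ (L : ℝ) ^ 2 / 2 := by
  rw [topCharge_eq_sum_arg, abs_div, abs_of_pos (by positivity : (0 : ℝ) < 2 * π),
    div_le_div_iff₀ (by positivity) (by positivity)]
  have hcard : (Finset.univ : Finset (Site 2 L)).card = L ^ 2 := by
    rw [Finset.card_univ, Fintype.card_fun, ZMod.card, Fintype.card_fin]
  calc |∑ x : Site 2 L, Complex.arg ((plaquetteHolonomy U x 0 1 : Circle) : ℂ)| * 2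
      ≤ (∑ x : Site 2 L, |Complex.arg ((plaquetteHolonomy U x 0 1 : Circle) : ℂ)|) * 2 := by
        gcongr; exact Finset.abs_sum_le_sum_abs _ _
    _ ≤ (∑ _x : Site 2 L, π) * 2 := by
        gcongr with x
        exact Complex.abs_arg_le_pi _
    _ = (L : ℝ) ^ 2 * (2 * π) := by
        rw [Finset.sum_const, hcard, nsmul_eq_mul]; push_cast; ring

/-- An integer charge of modulus `> L²/2` is never attained: the sector is EMPTY. -/
theorem topCharge_sector_eq_empty {k : ℤ} (hk : (L : ℝ) ^ 2 / 2 < |(k : ℝ)|) :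
    {U : GaugeConfig 2 L Circle | topCharge U = k} = ∅ := by
  ext U
  simp only [mem_setOf_eq, mem_empty_iff_false, iff_false]
  intro h
  have := abs_topCharge_le U
  rw [h] at this
  exact absurd hk (not_lt.2 this)

/-- **`P(Q = k) = 0` for `|k| > L²/2`.** -/
theorem wilsonMeasure_topCharge_eq_zero {k : ℤ} (hk : (L : ℝ) ^ 2 / 2 < |(k : ℝ)|) :
    wilsonMeasure (d := 2) (L := L) u1Rep β {U | topCharge U = k} = 0 := by
  rw [topCharge_sector_eq_empty hk, measure_empty]

/-- **The convolution power vanishes beyond its support**, read off from the law: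
`g_{L²}(2πk) = p_β^{*L²}(2πk) = 0` for `|k| > L²/2` (`L ≥ 2`). -/
theorem u1SectorWeight_eq_zero (hL : 2 ≤ L) {k : ℤ} (hk : (L : ℝ) ^ 2 / 2 < |(k : ℝ)|) :
    u1SectorWeight β (L ^ 2) k = 0 := by
  have h := wilsonMeasure_topCharge_eq_zero (L := L) β hk
  rw [wilsonMeasure_topCharge_eq β hL k, ENNReal.div_eq_zero_iff] at h
  exact h.resolve_right (tsum_u1SectorWeight_ne β hL).2

/-! ### 2. `Q` is a simple function -/

/-- The finite window of charges `|k| ≤ L²` (generously containing every attained value). -/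
theorem topCharge_mem_window (U : GaugeConfig 2 L Circle) :
    ∃ k ∈ Finset.Icc (-(L ^ 2 : ℤ)) (L ^ 2 : ℤ), topCharge U = k := by
  obtain ⟨k, hk⟩ := exists_int_eq_topCharge U
  refine ⟨k, Finset.mem_Icc.2 ?_, hk⟩
  have h := abs_topCharge_le U
  rw [hk] at h
  have h2 : |(k : ℝ)| ≤ (L : ℝ) ^ 2 := h.trans (by
    have : (0 : ℝ) ≤ (L : ℝ) ^ 2 := by positivity
    linarith)
  have h3 : |k| ≤ (L : ℤ) ^ 2 := by exact_mod_cast h2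
  constructor <;> [linarith [neg_abs_le k]; linarith [le_abs_self k]]

/-- **`Q` as a simple function**: for every `f`,
`f(Q(U)) = Σ_{|k| ≤ L²} 1{Q(U) = k} · f(k)`. -/
theorem sum_indicator_topCharge (f : ℝ → ℝ) (U : GaugeConfig 2 L Circle) :
    ∑ k ∈ Finset.Icc (-(L ^ 2 : ℤ)) (L ^ 2 : ℤ),
        {U : GaugeConfig 2 L Circle | topCharge U = k}.indicator (fun _ => f k) U = f (topCharge U) := by
  obtain ⟨k₀, hk₀, hU⟩ := topCharge_mem_window U
  rw [← Finset.sum_erase_add _ _ hk₀, indicator_of_mem (by exact hU), hU]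
  convert zero_add (f (k₀ : ℝ))
  refine Finset.sum_eq_zero fun k hk => ?_
  rw [indicator_of_notMem]
  intro (h : topCharge U = k)
  exact (Finset.mem_erase.1 hk).1 (Int.cast_injective (h.symm.trans hU))

/-! ### 3. Expectations of functions of `Q` -/

/-- The Wilson measure of 2-d `U(1)` is a probability measure (instance form, for `integral` lemmas). -/
instance : IsProbabilityMeasure (wilsonMeasure (d := 2) (L := L) u1Rep β) :=
  isProbabilityMeasure_wilsonMeasure (d := 2) (L := L) u1Rep continuous_u1Rep β

/-- **`∫ f(Q) dμ = Σ_{|k| ≤ L²} f(k) · P(Q = k)`** for every `f : ℝ → ℝ`. -/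
theorem integral_comp_topCharge (f : ℝ → ℝ) :
    ∫ U, f (topCharge U) ∂(wilsonMeasure (d := 2) (L := L) u1Rep β) =
      ∑ k ∈ Finset.Icc (-(L ^ 2 : ℤ)) (L ^ 2 : ℤ),
        f k * (wilsonMeasure (d := 2) (L := L) u1Rep β {U | topCharge U = k}).toReal := by
  have hS : ∀ k : ℤ, MeasurableSet {U : GaugeConfig 2 L Circle | topCharge U = k} :=
    fun k => measurable_topCharge (measurableSet_singleton _)
  simp_rw [← sum_indicator_topCharge f]
  rw [integral_finsetSum _ fun k _ => ?_]
  · refine Finset.sum_congr rfl fun k _ => ?_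
    rw [integral_indicator_const _ (hS k), smul_eq_mul, mul_comm]
    rfl
  · exact (integrable_const (f k)).indicator (hS k)

/-- **`⟨Q²⟩ = Σ_k k² · π_k`** — the oracle's `Q2` (`χ_Q = ⟨Q²⟩/L²`), with `π_k = P(Q = k)` given in
closed form by `wilsonMeasure_topCharge_eq` (the terms with `|k| > L²/2` vanish). -/
theorem integral_topCharge_sq :
    ∫ U, (topCharge U) ^ 2 ∂(wilsonMeasure (d := 2) (L := L) u1Rep β) =
      ∑ k ∈ Finset.Icc (-(L ^ 2 : ℤ)) (L ^ 2 : ℤ),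
        (k : ℝ) ^ 2 * (wilsonMeasure (d := 2) (L := L) u1Rep β {U | topCharge U = k}).toReal :=
  integral_comp_topCharge β fun q => q ^ 2

/-- **`⟨Q⟩ = 0`** (`L ≥ 2`): the law is symmetric under `k ↦ −k`
(`wilsonMeasure_topCharge_symm`). -/
theorem integral_topCharge (hL : 2 ≤ L) :
    ∫ U, topCharge U ∂(wilsonMeasure (d := 2) (L := L) u1Rep β) = 0 := by
  rw [show (fun U : GaugeConfig 2 L Circle => topCharge U) = fun U => id (topCharge U) from rfl,
    integral_comp_topCharge β id]
  simp only [id]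
  -- the summand is odd under the involution `k ↦ -k` of the symmetric window
  refine Finset.sum_involution (fun k _ => -k) ?_ ?_ ?_ ?_
  · intro k hk
    rw [wilsonMeasure_topCharge_symm β hL k, Int.cast_neg]
    ring
  · intro k hk hne h
    have hk0 : k = 0 := by omega
    subst hk0
    simp at hne
  · intro k hk
    simp only [Finset.mem_Icc] at hk ⊢
    omega
  · intro k hk
    exact neg_neg k

/-! ### 4. The law of `Q` as a discrete measure -/

/-- The preimage of a set of reals under `Q` is the disjoint union of the sectors it contains. -/
theorem topCharge_preimage_eq_iUnion (s : Set ℝ) :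
    (topCharge (L := L)) ⁻¹' s = ⋃ k : ℤ, {U : GaugeConfig 2 L Circle | topCharge U = k ∧ (k : ℝ) ∈ s} := by
  ext U
  simp only [Set.mem_preimage, mem_iUnion, mem_setOf_eq]
  constructor
  · intro h
    obtain ⟨k, hk⟩ := exists_int_eq_topCharge U
    exact ⟨k, hk, hk ▸ h⟩
  · rintro ⟨k, hk, hs⟩
    rwa [hk]

/-- **The law of the topological charge is the discrete measure `Σ_k P(Q = k) δ_k`** on `ℝ`
(push-forward of the Wilson measure under `topCharge`). -/
theorem wilsonMeasure_map_topCharge :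
    (wilsonMeasure (d := 2) (L := L) u1Rep β).map topCharge =
      Measure.sum fun k : ℤ =>
        wilsonMeasure (d := 2) (L := L) u1Rep β {U | topCharge U = k} • Measure.dirac (k : ℝ) := by
  ext s hs
  rw [Measure.map_apply measurable_topCharge hs, Measure.sum_apply _ hs, topCharge_preimage_eq_iUnion,
    measure_iUnion]
  · refine tsum_congr fun k => ?_
    rw [Measure.smul_apply, smul_eq_mul, Measure.dirac_apply' _ hs]
    by_cases hk : (k : ℝ) ∈ s
    · rw [indicator_of_mem hk, Pi.one_apply, mul_one]
      congr 1; ext U; simp [hk]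
    · rw [indicator_of_notMem hk, mul_zero]
      have : {U : GaugeConfig 2 L Circle | topCharge U = k ∧ (k : ℝ) ∈ s} = ∅ := by
        ext U; simp [hk]
      rw [this, measure_empty]
  · intro i j hij
    refine Set.disjoint_left.2 fun U hi hj => hij ?_
    have h : ((i : ℤ) : ℝ) = ((j : ℤ) : ℝ) := hi.1.symm.trans hj.1
    exact_mod_cast h
  · intro k
    by_cases hk : (k : ℝ) ∈ s
    · have : {U : GaugeConfig 2 L Circle | topCharge U = k ∧ (k : ℝ) ∈ s} =
          {U : GaugeConfig 2 L Circle | topCharge U = k} := by ext U; simp [hk]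
      rw [this]; exact measurable_topCharge (measurableSet_singleton _)
    · have : {U : GaugeConfig 2 L Circle | topCharge U = k ∧ (k : ℝ) ∈ s} = ∅ := by ext U; simp [hk]
      rw [this]; exact MeasurableSet.empty

end Summit.Ventures.LatticeQCDFlow.Scoring
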